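import Summits.MatrixMultiplication.MatrixMultiplication.Theorems.ObstructionDescentSchurWeylBorder
import Summits.MatrixMultiplication.MatrixMultiplication.Theorems.ObstructionDescentSaturationSplitTwo
import Mathlib.LinearAlgebra.Dual.Lemmas

set_option linter.dupNamespace false
set_option autoImplicit false

/-!
# Obstruction descent — the information dial is ONE pair of orbit-evaluation spans, read three ways
(decomp-mm · lens 3 · gen 31, def-free)

`route-MatrixMultiplication-ObstructionDescent` decides `ω(ℂ) = 2` by `closes (h₁ : NoOccurrenceObstruction) (h₂ : OccurrenceLifts)
(h₃ : MultiplicityDecides)` under the one equivalence layer `RankEventuallyQuadratic ⟺ ω(ℂ) = 2`.  Generations 28–30 certified the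
lens's translation of the FIRST binder (`P_O ⟺` semigroup containment `S(⟨n,n,n⟩) ⊆ S(⟨m⟩)` eventually; `P_O ⟺ SAT ∧ TOR`).  This file
applies the same dictionary to the SECOND language of the cut — multiplicities — and lands the first kernel on the cells of the second
binder `L = OccurrenceLifts` (stmt 29042).  THE OBJECT: for a format `m`, a type `Λ`, a degree `d` and a tensor `t`, the
ORBIT-EVALUATION SPAN `E_t(Λ,d) = span_ℂ {(f ↦ f(g·t))|_{HWV_{Λ,d}} : g ∈ GL_m³} ⊆ (HWV_{Λ,d})^*` (written out as a `Submodule.span`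
of restricted evaluation functionals; nothing is defined) — the image of `HWV_{Λ,d}` in `ℂ[closure(GL_m³·t)]_d`, seen dually.
* §1–§2  `E_t(Λ,d)^⊥ = HWV_{Λ,d} ∩ I(GL_m³·t)` (`dualCoannihilator_evalSpan_eq`), hence the DIMENSION FORMULA
  `dim E_t(Λ,d) + coMult t Λ d = dim HWV_{Λ,d}` (`finrank_evalSpan_add_coMult`): `dim E_t` is Bürgisser–Ikenmeyer's count of the
  copies of the type SURVIVING on the orbit closure.
* §3  THE DIAL.  For `u = ⟨m⟩` and `s = pad_m⟨n,n,n⟩` the three levels of the route's information axis are the three comparisons of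
  the SAME pair `E_s, E_u ⊆ (HWV_{Λ,d})^*`: occurrence inclusion `E_s ≠ 0 ⟹ E_u ≠ 0` (`evalSpan_eq_bot_iff`); multiplicity
  domination `dim E_s ≤ dim E_u` (`coMult_le_coMult_iff_finrank_evalSpan_le`); weight-vector-wise containment `E_s ⊆ E_u`
  (`evalSpan_le_evalSpan_iff : … ⟺ HWV_{Λ,d} ∩ I(GL³·u) ⊆ I(GL³·s)`, by `E^⊥⊥ = E`), each implying the previous; the top level
  follows from BORDER rank `bR(s) ≤ m` (Alder, gen-29 kernel): `evalSpan_le_evalSpan_of_algBorderRank_le`,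
  `coMult_le_of_algBorderRank_le` (the information axis had the rank version only).
* §4  TRANSPORTS.  `P_M ⟺ ∀ τ > 2, eventually dim E_pad ≤ dim E_unit` (`noMultiplicityObstruction_iff_evalSpan`);
  `P_O ⟺ … (E_pad ≠ 0 → E_unit ≠ 0)` (`noOccurrenceObstruction_iff_evalSpan`); `L ⟺ (rank-one shadow ⟹ dimension domination)`
  (`occurrenceLifts_iff_evalSpan`); the containment family `eventually E_pad ⊆ E_unit` sits between border rank eventually
  quadratic and `P_M` (`evalSpan_family_of_algBorderRank_eventually`, `noMultiplicityObstruction_of_evalSpan_family`).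
* §5  THE CELLS OF `L` (first instrument rows for item 29042).  The cell `(n,m)` — occurrence inclusion at `(n,m)` implies
  multiplicity domination at `(n,m)` — holds OUTSIDE the torsion window: vacuously for `m ≤ n² + 1` (Bürgisser–Ikenmeyer's `λₙ`
  obstructs: `not_cellO_of_le_sq_add_one`, `not_cellM_of_le_sq_add_one`) and genuinely for `m ≥ bR(⟨n,n,n⟩)`
  (`cellL_of_algBorderRank_le`); a failing cell of `L` is one where occurrence is blind, `pad_m⟨n,n,n⟩ ∉ σ_m`, and multiplicity
  sees (`cellO_and_lt_algBorderRank_of_not_cellL` — the Dörfler–Ikenmeyer–Panova phenomenon transplanted).  At `n = 2` every cell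
  `m ≥ 4`, `m ≠ 6`, of `L` holds and the row of `P_M` reads `m ≥ 7` (`cellL_two`, `cellM_two_iff`); the open cell `(2,6)` is `T_O1`.

No proposition is defined; no `def`; sorry-free; standard axioms.  Nothing here proves `ω = 2` or closes an item.
[cite: BurgisserIkenmeyer2011, §3.1 (occurrence, multiplicities of orbit closures), Prop. 3.3, Lemma 6.1]
[cite: DorflerIkenmeyerPanova2020, Thm. 2.3] [cite: BurgisserClausenShokrollahi1997, Thm. (20.3)] [cite: Strassen1969]
-/

noncomputable section

open scoped BigOperators

namespace Summit.MatrixMultiplication.MatrixMultiplication.Theorems.ObstructionCalculus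

open Literature.Computability.AlgebraicComplexity (actTensor matMulTensor unitTensor tensorRank algBorderRank
  tensorRank_matMulTensor_two_le_seven)
open Summit.MatrixMultiplication.MatrixMultiplication.Theses.ObstructionDescent
  (NoOccurrenceObstruction NoMultiplicityObstruction OccurrenceLifts)
open Summit.MatrixMultiplication.MatrixMultiplication.Theorems.ObstructionDescentInformationAxis
  (noOccurrenceObstruction_iff noMultiplicityObstruction_iff coMult_le_of_rank_le)

variable {m : ℕ}

/-! ## §1  The orbit-evaluation span and its annihilator -/

/-- **`E_t(Λ,d)^⊥ ∩ HWV = HWV ∩ I(GL³·t)`, member by member**: a weight vector is killed by every restricted orbit-evaluation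
functional of `t` iff it vanishes on the orbit `GL_m³·t`. [cite: BurgisserIkenmeyer2011, §3.1] -/
theorem mem_dualCoannihilator_evalSpan_iff (t : Tensor ℂ m) (Λ : Fin 3 → Fin m → ℕ) (d : ℕ) (f : hwvSpace Λ d) :
    f ∈ (Submodule.span ℂ {φ : Module.Dual ℂ (hwvSpace Λ d) | ∃ A B C : Matrix (Fin m) (Fin m) ℂ,
        A.det ≠ 0 ∧ B.det ≠ 0 ∧ C.det ≠ 0 ∧
        φ = (evalT (actTensor A B C t)).toLinearMap.domRestrict (hwvSpace Λ d)}).dualCoannihilator ↔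
      (f : MvPolynomial (Idx m) ℂ) ∈ orbitVanishing t := by
  rw [← SetLike.mem_coe, Submodule.coe_dualCoannihilator_span, Set.mem_setOf_eq, mem_orbitVanishing]
  constructor
  · intro h A B C hA hB hC
    have h' := h _ ⟨A, B, C, hA, hB, hC, rfl⟩
    simpa using h'
  · rintro h φ ⟨A, B, C, hA, hB, hC, rfl⟩
    simpa using h A B C hA hB hC

/-- **`E_t(Λ,d)^⊥ = HWV_{Λ,d} ∩ I(GL³·t)`** as subspaces of `HWV_{Λ,d}`. [cite: BurgisserIkenmeyer2011, §3.1] -/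
theorem dualCoannihilator_evalSpan_eq (t : Tensor ℂ m) (Λ : Fin 3 → Fin m → ℕ) (d : ℕ) :
    (Submodule.span ℂ {φ : Module.Dual ℂ (hwvSpace Λ d) | ∃ A B C : Matrix (Fin m) (Fin m) ℂ,
        A.det ≠ 0 ∧ B.det ≠ 0 ∧ C.det ≠ 0 ∧
        φ = (evalT (actTensor A B C t)).toLinearMap.domRestrict (hwvSpace Λ d)}).dualCoannihilator =
      (orbitVanishing t).comap (hwvSpace Λ d).subtype := by
  ext f
  rw [mem_dualCoannihilator_evalSpan_iff, Submodule.mem_comap, Submodule.subtype_apply]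

/-- The pulled-back vanishing subspace has dimension `coMult t Λ d`. [bookkeeping] -/
theorem finrank_comap_subtype_orbitVanishing (t : Tensor ℂ m) (Λ : Fin 3 → Fin m → ℕ) (d : ℕ) :
    Module.finrank ℂ ((orbitVanishing t).comap (hwvSpace Λ d).subtype) = coMult t Λ d := by
  have h1 : (orbitVanishing t).comap (hwvSpace Λ d).subtype =
      (hwvSpace Λ d ⊓ orbitVanishing t).comap (hwvSpace Λ d).subtype := by
    rw [Submodule.comap_inf, Submodule.comap_subtype_self, top_inf_eq]
  rw [h1, (Submodule.comapSubtypeEquivOfLe (inf_le_left : hwvSpace Λ d ⊓ orbitVanishing t ≤ hwvSpace Λ d)).finrank_eq]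
  rfl

/-! ## §2  The dimension formula -/

/-- **`dim E_t(Λ,d) + coMult t Λ d = dim HWV_{Λ,d}`**: the orbit-evaluation span has dimension the number of independent
weight vectors of the type surviving on `closure(GL_m³·t)` (Bürgisser–Ikenmeyer's multiplicity count), the co-multiplicity
being its complement. [cite: BurgisserIkenmeyer2011, §3.1] -/
theorem finrank_evalSpan_add_coMult (t : Tensor ℂ m) (Λ : Fin 3 → Fin m → ℕ) (d : ℕ) :
    Module.finrank ℂ (Submodule.span ℂ {φ : Module.Dual ℂ (hwvSpace Λ d) | ∃ A B C : Matrix (Fin m) (Fin m) ℂ,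
        A.det ≠ 0 ∧ B.det ≠ 0 ∧ C.det ≠ 0 ∧
        φ = (evalT (actTensor A B C t)).toLinearMap.domRestrict (hwvSpace Λ d)}) + coMult t Λ d =
      Module.finrank ℂ (hwvSpace Λ d) := by
  haveI := finite_hwvSpace (m := m) Λ d
  rw [← finrank_comap_subtype_orbitVanishing, ← dualCoannihilator_evalSpan_eq]
  exact Subspace.finrank_add_finrank_dualCoannihilator_eq _

/-! ## §3  The dial: non-vanishing / dimension / containment of the same pair of spans -/

/-- **Occurrence level.**  `E_t(Λ,d) = 0 ⟺ HWV_{Λ,d} ⊆ I(GL_m³·t)`: the type does NOT occur for `t` iff its orbit-evaluation span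
vanishes. [cite: BurgisserIkenmeyer2011, §3.1] -/
theorem evalSpan_eq_bot_iff (t : Tensor ℂ m) (Λ : Fin 3 → Fin m → ℕ) (d : ℕ) :
    Submodule.span ℂ {φ : Module.Dual ℂ (hwvSpace Λ d) | ∃ A B C : Matrix (Fin m) (Fin m) ℂ,
        A.det ≠ 0 ∧ B.det ≠ 0 ∧ C.det ≠ 0 ∧
        φ = (evalT (actTensor A B C t)).toLinearMap.domRestrict (hwvSpace Λ d)} = ⊥ ↔
      hwvSpace Λ d ≤ orbitVanishing t := by
  rw [Submodule.span_eq_bot]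
  constructor
  · intro h f hf
    rw [mem_orbitVanishing]
    intro A B C hA hB hC
    have h' := LinearMap.congr_fun (h _ ⟨A, B, C, hA, hB, hC, rfl⟩) ⟨f, hf⟩
    simpa using h'
  · rintro h φ ⟨A, B, C, hA, hB, hC, rfl⟩
    ext f
    simpa using (mem_orbitVanishing.1 (h f.2)) A B C hA hB hC

/-- **Multiplicity level.**  `coMult u Λ d ≤ coMult s Λ d ⟺ dim E_s(Λ,d) ≤ dim E_u(Λ,d)`: multiplicity domination of `s` by `u`
is domination of the dimensions of the orbit-evaluation spans (dimension formula §2 on both sides).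
[cite: BurgisserIkenmeyer2011, §3.1] -/
theorem coMult_le_coMult_iff_finrank_evalSpan_le (u s : Tensor ℂ m) (Λ : Fin 3 → Fin m → ℕ) (d : ℕ) :
    coMult u Λ d ≤ coMult s Λ d ↔
      Module.finrank ℂ (Submodule.span ℂ {φ : Module.Dual ℂ (hwvSpace Λ d) | ∃ A B C : Matrix (Fin m) (Fin m) ℂ,
          A.det ≠ 0 ∧ B.det ≠ 0 ∧ C.det ≠ 0 ∧
          φ = (evalT (actTensor A B C s)).toLinearMap.domRestrict (hwvSpace Λ d)}) ≤
        Module.finrank ℂ (Submodule.span ℂ {φ : Module.Dual ℂ (hwvSpace Λ d) | ∃ A B C : Matrix (Fin m) (Fin m) ℂ,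
          A.det ≠ 0 ∧ B.det ≠ 0 ∧ C.det ≠ 0 ∧
          φ = (evalT (actTensor A B C u)).toLinearMap.domRestrict (hwvSpace Λ d)}) := by
  have hu := finrank_evalSpan_add_coMult u Λ d
  have hs := finrank_evalSpan_add_coMult s Λ d
  omega

/-- **Weight-vector level.**  `E_s(Λ,d) ⊆ E_u(Λ,d) ⟺ HWV_{Λ,d} ∩ I(GL³·u) ⊆ I(GL³·s)`: every restricted orbit-evaluation
functional of `s` is a linear combination of those of `u` iff every weight vector of the type vanishing on the orbit of `u`
vanishes on the orbit of `s` (finite-dimensional duality `E = E^⊥⊥` inside `(HWV_{Λ,d})^*`).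
[cite: BurgisserIkenmeyer2011, §3.1] -/
theorem evalSpan_le_evalSpan_iff (u s : Tensor ℂ m) (Λ : Fin 3 → Fin m → ℕ) (d : ℕ) :
    Submodule.span ℂ {φ : Module.Dual ℂ (hwvSpace Λ d) | ∃ A B C : Matrix (Fin m) (Fin m) ℂ,
          A.det ≠ 0 ∧ B.det ≠ 0 ∧ C.det ≠ 0 ∧
          φ = (evalT (actTensor A B C s)).toLinearMap.domRestrict (hwvSpace Λ d)} ≤
        Submodule.span ℂ {φ : Module.Dual ℂ (hwvSpace Λ d) | ∃ A B C : Matrix (Fin m) (Fin m) ℂ,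
          A.det ≠ 0 ∧ B.det ≠ 0 ∧ C.det ≠ 0 ∧
          φ = (evalT (actTensor A B C u)).toLinearMap.domRestrict (hwvSpace Λ d)} ↔
      hwvSpace Λ d ⊓ orbitVanishing u ≤ orbitVanishing s := by
  haveI := finite_hwvSpace (m := m) Λ d
  constructor
  · intro h f hf
    have hmem := (mem_dualCoannihilator_evalSpan_iff u Λ d ⟨f, hf.1⟩).2 hf.2
    exact (mem_dualCoannihilator_evalSpan_iff s Λ d ⟨f, hf.1⟩).1 (Submodule.dualCoannihilator_anti h hmem)
  · intro h
    have hco : (Submodule.span ℂ {φ : Module.Dual ℂ (hwvSpace Λ d) | ∃ A B C : Matrix (Fin m) (Fin m) ℂ,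
          A.det ≠ 0 ∧ B.det ≠ 0 ∧ C.det ≠ 0 ∧
          φ = (evalT (actTensor A B C u)).toLinearMap.domRestrict (hwvSpace Λ d)}).dualCoannihilator ≤
        (Submodule.span ℂ {φ : Module.Dual ℂ (hwvSpace Λ d) | ∃ A B C : Matrix (Fin m) (Fin m) ℂ,
          A.det ≠ 0 ∧ B.det ≠ 0 ∧ C.det ≠ 0 ∧
          φ = (evalT (actTensor A B C s)).toLinearMap.domRestrict (hwvSpace Λ d)}).dualCoannihilator := by
      intro f hf
      rw [mem_dualCoannihilator_evalSpan_iff] at hf ⊢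
      exact h ⟨f.2, hf⟩
    have hann := Submodule.dualAnnihilator_anti hco
    rwa [Subspace.dualCoannihilator_dualAnnihilator_eq, Subspace.dualCoannihilator_dualAnnihilator_eq] at hann

/-- The weight-vector level implies the multiplicity level (`dim` is monotone). [bookkeeping] -/
theorem coMult_le_coMult_of_evalSpan_le {u s : Tensor ℂ m} {Λ : Fin 3 → Fin m → ℕ} {d : ℕ}
    (h : Submodule.span ℂ {φ : Module.Dual ℂ (hwvSpace Λ d) | ∃ A B C : Matrix (Fin m) (Fin m) ℂ,
          A.det ≠ 0 ∧ B.det ≠ 0 ∧ C.det ≠ 0 ∧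
          φ = (evalT (actTensor A B C s)).toLinearMap.domRestrict (hwvSpace Λ d)} ≤
        Submodule.span ℂ {φ : Module.Dual ℂ (hwvSpace Λ d) | ∃ A B C : Matrix (Fin m) (Fin m) ℂ,
          A.det ≠ 0 ∧ B.det ≠ 0 ∧ C.det ≠ 0 ∧
          φ = (evalT (actTensor A B C u)).toLinearMap.domRestrict (hwvSpace Λ d)}) :
    coMult u Λ d ≤ coMult s Λ d := by
  haveI := finite_hwvSpace (m := m) Λ d
  exact (coMult_le_coMult_iff_finrank_evalSpan_le u s Λ d).2 (Submodule.finrank_mono h)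

/-- The multiplicity level implies the occurrence level, in span language: if `dim E_s ≤ dim E_u` and `E_s ≠ 0` then `E_u ≠ 0`.
[bookkeeping] -/
theorem evalSpan_ne_bot_of_coMult_le {u s : Tensor ℂ m} {Λ : Fin 3 → Fin m → ℕ} {d : ℕ}
    (hle : coMult u Λ d ≤ coMult s Λ d)
    (hs : Submodule.span ℂ {φ : Module.Dual ℂ (hwvSpace Λ d) | ∃ A B C : Matrix (Fin m) (Fin m) ℂ,
          A.det ≠ 0 ∧ B.det ≠ 0 ∧ C.det ≠ 0 ∧
          φ = (evalT (actTensor A B C s)).toLinearMap.domRestrict (hwvSpace Λ d)} ≠ ⊥) :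
    Submodule.span ℂ {φ : Module.Dual ℂ (hwvSpace Λ d) | ∃ A B C : Matrix (Fin m) (Fin m) ℂ,
          A.det ≠ 0 ∧ B.det ≠ 0 ∧ C.det ≠ 0 ∧
          φ = (evalT (actTensor A B C u)).toLinearMap.domRestrict (hwvSpace Λ d)} ≠ ⊥ := by
  intro hu
  exact hs ((evalSpan_eq_bot_iff s Λ d).2
    (hwvSpace_le_orbitVanishing_of_coMult_le hle ((evalSpan_eq_bot_iff u Λ d).1 hu)))

/-- **Full ideal containment gives the top level at every type**: if every polynomial vanishing on `GL³·u` vanishes on `GL³·s`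
then `E_s(Λ,d) ⊆ E_u(Λ,d)` for all `Λ, d`. [cite: BurgisserIkenmeyer2011, §3.1] -/
theorem evalSpan_le_evalSpan_of_orbitVanishing_le {u s : Tensor ℂ m} (h : orbitVanishing u ≤ orbitVanishing s)
    (Λ : Fin 3 → Fin m → ℕ) (d : ℕ) :
    Submodule.span ℂ {φ : Module.Dual ℂ (hwvSpace Λ d) | ∃ A B C : Matrix (Fin m) (Fin m) ℂ,
          A.det ≠ 0 ∧ B.det ≠ 0 ∧ C.det ≠ 0 ∧
          φ = (evalT (actTensor A B C s)).toLinearMap.domRestrict (hwvSpace Λ d)} ≤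
        Submodule.span ℂ {φ : Module.Dual ℂ (hwvSpace Λ d) | ∃ A B C : Matrix (Fin m) (Fin m) ℂ,
          A.det ≠ 0 ∧ B.det ≠ 0 ∧ C.det ≠ 0 ∧
          φ = (evalT (actTensor A B C u)).toLinearMap.domRestrict (hwvSpace Λ d)} :=
  (evalSpan_le_evalSpan_iff u s Λ d).2 fun _ hf => h hf.2

/-- **Border rank gives the top level**: if `bR(⟨n,n,n⟩) ≤ m` (`n² ≤ m`) then `E_pad(Λ,d) ⊆ E_unit(Λ,d)` for every type and
degree — every restricted orbit-evaluation functional of `pad_m⟨n,n,n⟩` is a combination of those of `⟨m⟩` (Alder's theorem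
`σ_m = {bR ≤ m}`, gen-29 kernel `orbitVanishing_unitTensor_le_of_algBorderRank_le`).
[cite: BurgisserClausenShokrollahi1997, Thm. (20.3)] [cite: BurgisserIkenmeyer2011, §3.1] -/
theorem evalSpan_le_evalSpan_of_algBorderRank_le {n : ℕ} (h : n * n ≤ m)
    (hbr : algBorderRank (matMulTensor ℂ n n n) ≤ m) (Λ : Fin 3 → Fin m → ℕ) (d : ℕ) :
    Submodule.span ℂ {φ : Module.Dual ℂ (hwvSpace Λ d) | ∃ A B C : Matrix (Fin m) (Fin m) ℂ,
          A.det ≠ 0 ∧ B.det ≠ 0 ∧ C.det ≠ 0 ∧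
          φ = (evalT (actTensor A B C (padMM ℂ n m h))).toLinearMap.domRestrict (hwvSpace Λ d)} ≤
        Submodule.span ℂ {φ : Module.Dual ℂ (hwvSpace Λ d) | ∃ A B C : Matrix (Fin m) (Fin m) ℂ,
          A.det ≠ 0 ∧ B.det ≠ 0 ∧ C.det ≠ 0 ∧
          φ = (evalT (actTensor A B C (unitTensor ℂ m))).toLinearMap.domRestrict (hwvSpace Λ d)} :=
  evalSpan_le_evalSpan_of_orbitVanishing_le
    (orbitVanishing_unitTensor_le_of_algBorderRank_le ((algBorderRank_padMM h).le.trans hbr)) Λ d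

/-- **Multiplicity domination above the BORDER rank**: `bR(⟨n,n,n⟩) ≤ m` (`n² ≤ m`) forces
`coMult ⟨m⟩ Λ d ≤ coMult pad_m⟨n,n,n⟩ Λ d` for every type and degree — the cell `(n,m)` of `P_M` (the information axis had the
rank version `coMult_le_of_rank_le`). [cite: BurgisserClausenShokrollahi1997, Thm. (20.3)] [cite: BurgisserIkenmeyer2011, §3.1] -/
theorem coMult_le_of_algBorderRank_le {n : ℕ} (h : n * n ≤ m) (hbr : algBorderRank (matMulTensor ℂ n n n) ≤ m)
    (Λ : Fin 3 → Fin m → ℕ) (d : ℕ) : coMult (unitTensor ℂ m) Λ d ≤ coMult (padMM ℂ n m h) Λ d :=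
  coMult_le_coMult_of_evalSpan_le (evalSpan_le_evalSpan_of_algBorderRank_le h hbr Λ d)

/-! ## §4  Transports: the cut pieces in span language -/

/-- **`P_M` in span language**: no multiplicity obstruction above the quadratic scale iff, for every `τ > 2`, eventually in `n`,
at every format `m ≥ n^τ` (`m ≥ n²`) and every type and degree, `dim E_pad(Λ,d) ≤ dim E_unit(Λ,d)` — on every space of weight
vectors the orbit of `⟨m⟩` spans at least as many independent evaluation functionals as the orbit of `pad_m⟨n,n,n⟩`.
[cite: BurgisserIkenmeyer2011, §3.1] -/
theorem noMultiplicityObstruction_iff_evalSpan : NoMultiplicityObstruction ↔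
    ∀ τ : ℝ, 2 < τ → ∃ n₀ : ℕ, ∀ n m : ℕ, n₀ ≤ n → ∀ h : n * n ≤ m, (n : ℝ) ^ τ ≤ (m : ℝ) →
      ∀ (Λ : Fin 3 → Fin m → ℕ) (d : ℕ),
        Module.finrank ℂ (Submodule.span ℂ {φ : Module.Dual ℂ (hwvSpace Λ d) | ∃ A B C : Matrix (Fin m) (Fin m) ℂ,
            A.det ≠ 0 ∧ B.det ≠ 0 ∧ C.det ≠ 0 ∧
            φ = (evalT (actTensor A B C (padMM ℂ n m h))).toLinearMap.domRestrict (hwvSpace Λ d)}) ≤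
          Module.finrank ℂ (Submodule.span ℂ {φ : Module.Dual ℂ (hwvSpace Λ d) | ∃ A B C : Matrix (Fin m) (Fin m) ℂ,
            A.det ≠ 0 ∧ B.det ≠ 0 ∧ C.det ≠ 0 ∧
            φ = (evalT (actTensor A B C (unitTensor ℂ m))).toLinearMap.domRestrict (hwvSpace Λ d)}) := by
  rw [noMultiplicityObstruction_iff]
  simp only [coMult_le_coMult_iff_finrank_evalSpan_le]

/-- **`P_O` in span language**: no occurrence obstruction above the quadratic scale iff, eventually and at every format
`m ≥ n^τ`, `E_pad(Λ,d) ≠ 0 ⟹ E_unit(Λ,d) ≠ 0` — the rank-`≥ 1` shadow of the previous statement.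
[cite: BurgisserIkenmeyer2011, §3.1] -/
theorem noOccurrenceObstruction_iff_evalSpan : NoOccurrenceObstruction ↔
    ∀ τ : ℝ, 2 < τ → ∃ n₀ : ℕ, ∀ n m : ℕ, n₀ ≤ n → ∀ h : n * n ≤ m, (n : ℝ) ^ τ ≤ (m : ℝ) →
      ∀ (Λ : Fin 3 → Fin m → ℕ) (d : ℕ),
        Submodule.span ℂ {φ : Module.Dual ℂ (hwvSpace Λ d) | ∃ A B C : Matrix (Fin m) (Fin m) ℂ,
            A.det ≠ 0 ∧ B.det ≠ 0 ∧ C.det ≠ 0 ∧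
            φ = (evalT (actTensor A B C (padMM ℂ n m h))).toLinearMap.domRestrict (hwvSpace Λ d)} ≠ ⊥ →
          Submodule.span ℂ {φ : Module.Dual ℂ (hwvSpace Λ d) | ∃ A B C : Matrix (Fin m) (Fin m) ℂ,
            A.det ≠ 0 ∧ B.det ≠ 0 ∧ C.det ≠ 0 ∧
            φ = (evalT (actTensor A B C (unitTensor ℂ m))).toLinearMap.domRestrict (hwvSpace Λ d)} ≠ ⊥ := by
  rw [noOccurrenceObstruction_iff]
  simp only [Ne, evalSpan_eq_bot_iff, not_imp_not]

/-- **`L` in span language**: `OccurrenceLifts` says that the rank-one shadow (non-vanishing is inherited from `pad` to `unit`)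
upgrades to dimension domination, family-wise. [cite: DorflerIkenmeyerPanova2020, Thm. 2.3] -/
theorem occurrenceLifts_iff_evalSpan : OccurrenceLifts ↔
    ((∀ τ : ℝ, 2 < τ → ∃ n₀ : ℕ, ∀ n m : ℕ, n₀ ≤ n → ∀ h : n * n ≤ m, (n : ℝ) ^ τ ≤ (m : ℝ) →
      ∀ (Λ : Fin 3 → Fin m → ℕ) (d : ℕ),
        Submodule.span ℂ {φ : Module.Dual ℂ (hwvSpace Λ d) | ∃ A B C : Matrix (Fin m) (Fin m) ℂ,
            A.det ≠ 0 ∧ B.det ≠ 0 ∧ C.det ≠ 0 ∧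
            φ = (evalT (actTensor A B C (padMM ℂ n m h))).toLinearMap.domRestrict (hwvSpace Λ d)} ≠ ⊥ →
          Submodule.span ℂ {φ : Module.Dual ℂ (hwvSpace Λ d) | ∃ A B C : Matrix (Fin m) (Fin m) ℂ,
            A.det ≠ 0 ∧ B.det ≠ 0 ∧ C.det ≠ 0 ∧
            φ = (evalT (actTensor A B C (unitTensor ℂ m))).toLinearMap.domRestrict (hwvSpace Λ d)} ≠ ⊥) →
    (∀ τ : ℝ, 2 < τ → ∃ n₀ : ℕ, ∀ n m : ℕ, n₀ ≤ n → ∀ h : n * n ≤ m, (n : ℝ) ^ τ ≤ (m : ℝ) →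
      ∀ (Λ : Fin 3 → Fin m → ℕ) (d : ℕ),
        Module.finrank ℂ (Submodule.span ℂ {φ : Module.Dual ℂ (hwvSpace Λ d) | ∃ A B C : Matrix (Fin m) (Fin m) ℂ,
            A.det ≠ 0 ∧ B.det ≠ 0 ∧ C.det ≠ 0 ∧
            φ = (evalT (actTensor A B C (padMM ℂ n m h))).toLinearMap.domRestrict (hwvSpace Λ d)}) ≤
          Module.finrank ℂ (Submodule.span ℂ {φ : Module.Dual ℂ (hwvSpace Λ d) | ∃ A B C : Matrix (Fin m) (Fin m) ℂ,
            A.det ≠ 0 ∧ B.det ≠ 0 ∧ C.det ≠ 0 ∧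
            φ = (evalT (actTensor A B C (unitTensor ℂ m))).toLinearMap.domRestrict (hwvSpace Λ d)}))) := by
  unfold OccurrenceLifts
  rw [noOccurrenceObstruction_iff_evalSpan, noMultiplicityObstruction_iff_evalSpan]

/-- **The containment family implies `P_M`**: if for every `τ > 2`, eventually, `E_pad(Λ,d) ⊆ E_unit(Λ,d)` at every format
`m ≥ n^τ` and every type and degree, then `NoMultiplicityObstruction`. [cite: BurgisserIkenmeyer2011, §3.1] -/
theorem noMultiplicityObstruction_of_evalSpan_family
    (hE : ∀ τ : ℝ, 2 < τ → ∃ n₀ : ℕ, ∀ n m : ℕ, n₀ ≤ n → ∀ h : n * n ≤ m, (n : ℝ) ^ τ ≤ (m : ℝ) →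
      ∀ (Λ : Fin 3 → Fin m → ℕ) (d : ℕ),
        Submodule.span ℂ {φ : Module.Dual ℂ (hwvSpace Λ d) | ∃ A B C : Matrix (Fin m) (Fin m) ℂ,
            A.det ≠ 0 ∧ B.det ≠ 0 ∧ C.det ≠ 0 ∧
            φ = (evalT (actTensor A B C (padMM ℂ n m h))).toLinearMap.domRestrict (hwvSpace Λ d)} ≤
          Submodule.span ℂ {φ : Module.Dual ℂ (hwvSpace Λ d) | ∃ A B C : Matrix (Fin m) (Fin m) ℂ,
            A.det ≠ 0 ∧ B.det ≠ 0 ∧ C.det ≠ 0 ∧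
            φ = (evalT (actTensor A B C (unitTensor ℂ m))).toLinearMap.domRestrict (hwvSpace Λ d)}) :
    NoMultiplicityObstruction := by
  refine noMultiplicityObstruction_iff.2 fun τ hτ => ?_
  obtain ⟨n₀, hn₀⟩ := hE τ hτ
  exact ⟨n₀, fun n m hn h hτm Λ d => coMult_le_coMult_of_evalSpan_le (hn₀ n m hn h hτm Λ d)⟩

/-- **Border rank eventually quadratic gives the containment family** (the top of the dial; over `ℂ` the hypothesis is
summit-strength by Bini, so this is a NEC-type certificate, not progress on `ω`). [cite: BurgisserClausenShokrollahi1997, Thm. (20.3)] -/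
theorem evalSpan_family_of_algBorderRank_eventually
    (hbr : ∀ τ : ℝ, 2 < τ → ∃ n₀ : ℕ, ∀ n : ℕ, n₀ ≤ n → (algBorderRank (matMulTensor ℂ n n n) : ℝ) ≤ (n : ℝ) ^ τ) :
    ∀ τ : ℝ, 2 < τ → ∃ n₀ : ℕ, ∀ n m : ℕ, n₀ ≤ n → ∀ h : n * n ≤ m, (n : ℝ) ^ τ ≤ (m : ℝ) →
      ∀ (Λ : Fin 3 → Fin m → ℕ) (d : ℕ),
        Submodule.span ℂ {φ : Module.Dual ℂ (hwvSpace Λ d) | ∃ A B C : Matrix (Fin m) (Fin m) ℂ,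
            A.det ≠ 0 ∧ B.det ≠ 0 ∧ C.det ≠ 0 ∧
            φ = (evalT (actTensor A B C (padMM ℂ n m h))).toLinearMap.domRestrict (hwvSpace Λ d)} ≤
          Submodule.span ℂ {φ : Module.Dual ℂ (hwvSpace Λ d) | ∃ A B C : Matrix (Fin m) (Fin m) ℂ,
            A.det ≠ 0 ∧ B.det ≠ 0 ∧ C.det ≠ 0 ∧
            φ = (evalT (actTensor A B C (unitTensor ℂ m))).toLinearMap.domRestrict (hwvSpace Λ d)} := by
  intro τ hτ
  obtain ⟨n₀, hn₀⟩ := hbr τ hτ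
  refine ⟨n₀, fun n m hn h hτm Λ d => evalSpan_le_evalSpan_of_algBorderRank_le h ?_ Λ d⟩
  exact_mod_cast (hn₀ n hn).trans hτm

/-! ## §5  The cells of `L = OccurrenceLifts` (item 29042): decided outside the torsion window -/

/-- **Below the diagonal `m ≤ n² + 1` the cell of `P_O` FAILS** (calculus form of the gen-30 kernel
`not_semigroup_le_of_le_sq_add_one`: Bürgisser–Ikenmeyer's `λₙ ⊢ 2n²` occurs for `pad_m⟨n,n,n⟩` and not for `⟨m⟩`).
[cite: BurgisserIkenmeyer2011, Lemma 6.1] -/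
theorem not_cellO_of_le_sq_add_one (n : ℕ) (hn : 2 ≤ n) (h : n * n ≤ m) (hm : m ≤ n ^ 2 + 1) :
    ¬ (∀ (Λ : Fin 3 → Fin m → ℕ) (d : ℕ), hwvSpace Λ d ≤ orbitVanishing (unitTensor ℂ m) →
        hwvSpace Λ d ≤ orbitVanishing (padMM ℂ n m h)) := fun hP =>
  not_semigroup_le_of_le_sq_add_one n hn hm ((hwvSpace_le_imp_iff_semigroup_containment n m h).1 hP)

/-- **… hence the cell of `P_M` fails there too**: `λₙ` is also a multiplicity obstruction (multiplicity domination would force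
occurrence inclusion, `hwvSpace_le_orbitVanishing_of_coMult_le`). [cite: BurgisserIkenmeyer2011, Lemma 6.1, §3.1] -/
theorem not_cellM_of_le_sq_add_one (n : ℕ) (hn : 2 ≤ n) (h : n * n ≤ m) (hm : m ≤ n ^ 2 + 1) :
    ¬ (∀ (Λ : Fin 3 → Fin m → ℕ) (d : ℕ), coMult (unitTensor ℂ m) Λ d ≤ coMult (padMM ℂ n m h) Λ d) := fun hM =>
  not_cellO_of_le_sq_add_one n hn h hm fun Λ d hu => hwvSpace_le_orbitVanishing_of_coMult_le (hM Λ d) hu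

/-- **The cell of `L` holds VACUOUSLY below the diagonal** (`m ≤ n² + 1`): occurrence is not blind there, so "occurrence
inclusion ⟹ multiplicity domination" has a false premise. [cite: BurgisserIkenmeyer2011, Lemma 6.1] -/
theorem cellL_of_le_sq_add_one (n : ℕ) (hn : 2 ≤ n) (h : n * n ≤ m) (hm : m ≤ n ^ 2 + 1) :
    (∀ (Λ : Fin 3 → Fin m → ℕ) (d : ℕ), hwvSpace Λ d ≤ orbitVanishing (unitTensor ℂ m) →
        hwvSpace Λ d ≤ orbitVanishing (padMM ℂ n m h)) →
      ∀ (Λ : Fin 3 → Fin m → ℕ) (d : ℕ), coMult (unitTensor ℂ m) Λ d ≤ coMult (padMM ℂ n m h) Λ d :=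
  fun hP => absurd hP (not_cellO_of_le_sq_add_one n hn h hm)

/-- **The cell of `L` holds GENUINELY above the border rank** (`m ≥ bR(⟨n,n,n⟩)`): multiplicity domination holds outright there
(`coMult_le_of_algBorderRank_le`). [cite: BurgisserClausenShokrollahi1997, Thm. (20.3)] [cite: BurgisserIkenmeyer2011, §3.1] -/
theorem cellL_of_algBorderRank_le {n : ℕ} (h : n * n ≤ m) (hbr : algBorderRank (matMulTensor ℂ n n n) ≤ m) :
    (∀ (Λ : Fin 3 → Fin m → ℕ) (d : ℕ), hwvSpace Λ d ≤ orbitVanishing (unitTensor ℂ m) →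
        hwvSpace Λ d ≤ orbitVanishing (padMM ℂ n m h)) →
      ∀ (Λ : Fin 3 → Fin m → ℕ) (d : ℕ), coMult (unitTensor ℂ m) Λ d ≤ coMult (padMM ℂ n m h) Λ d :=
  fun _ Λ d => coMult_le_of_algBorderRank_le h hbr Λ d

/-- **Where `L` can fail.**  If the cell `(n,m)` of `L` fails then (i) the cell of `P_O` HOLDS there (`S(⟨n,n,n⟩) ⊆ S(⟨m⟩)`:
occurrence is blind) although (ii) `bR(⟨n,n,n⟩) > m` (`pad_m⟨n,n,n⟩ ∉ σ_m`) and (iii) some multiplicity obstruction exists —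
exactly a cell exhibiting the Dörfler–Ikenmeyer–Panova phenomenon for the pair (matrix multiplication, unit tensor).
[cite: DorflerIkenmeyerPanova2020, Thm. 2.3] [cite: BurgisserIkenmeyer2011, §3.1] -/
theorem cellO_and_lt_algBorderRank_of_not_cellL {n : ℕ} (h : n * n ≤ m)
    (hL : ¬ ((∀ (Λ : Fin 3 → Fin m → ℕ) (d : ℕ), hwvSpace Λ d ≤ orbitVanishing (unitTensor ℂ m) →
        hwvSpace Λ d ≤ orbitVanishing (padMM ℂ n m h)) →
      ∀ (Λ : Fin 3 → Fin m → ℕ) (d : ℕ), coMult (unitTensor ℂ m) Λ d ≤ coMult (padMM ℂ n m h) Λ d)) :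
    (∀ (Λ : Fin 3 → Fin m → ℕ) (d : ℕ), hwvSpace Λ d ≤ orbitVanishing (unitTensor ℂ m) →
        hwvSpace Λ d ≤ orbitVanishing (padMM ℂ n m h)) ∧
      m < algBorderRank (matMulTensor ℂ n n n) ∧
      ∃ (Λ : Fin 3 → Fin m → ℕ) (d : ℕ), coMult (padMM ℂ n m h) Λ d < coMult (unitTensor ℂ m) Λ d := by
  rw [Classical.not_imp] at hL
  obtain ⟨hO, hM⟩ := hL
  refine ⟨hO, ?_, ?_⟩
  · by_contra hbr
    exact hM (cellL_of_algBorderRank_le h (not_lt.1 hbr) hO)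
  · by_contra hno
    exact hM fun Λ d => not_lt.1 fun hlt => hno ⟨Λ, d, hlt⟩

/-- **The `n = 2` row of `L` is decided at every format except `m = 6`.**  For `4 ≤ m`, `m ≠ 6`: occurrence inclusion at `(2,m)`
implies multiplicity domination at `(2,m)` — vacuously for `m ∈ {4,5}` (`λ₂ = ((5,1,1,1),(2⁴),(2⁴)) ⊢ 8` obstructs), genuinely
for `m ≥ 7 = R(⟨2,2,2⟩)` (Strassen).  The open cell `(2,6)` (`bR(⟨2,2,2⟩) = 7 > 6`, Landsberg / Hauenstein–Ikenmeyer–Landsberg)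
is the route's instrument `T_O1`. [cite: BurgisserIkenmeyer2011, Lemma 6.1] [cite: Strassen1969] -/
theorem cellL_two (h : 2 * 2 ≤ m) (hm6 : m ≠ 6) :
    (∀ (Λ : Fin 3 → Fin m → ℕ) (d : ℕ), hwvSpace Λ d ≤ orbitVanishing (unitTensor ℂ m) →
        hwvSpace Λ d ≤ orbitVanishing (padMM ℂ 2 m h)) →
      ∀ (Λ : Fin 3 → Fin m → ℕ) (d : ℕ), coMult (unitTensor ℂ m) Λ d ≤ coMult (padMM ℂ 2 m h) Λ d := by
  rcases Nat.lt_or_ge 5 m with hm5 | hm5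
  · have hm7 : 7 ≤ m := by omega
    exact fun _ Λ d => coMult_le_of_rank_le h ((tensorRank_matMulTensor_two_le_seven ℂ).trans hm7) Λ d
  · exact cellL_of_le_sq_add_one 2 le_rfl h (by omega)

/-- **The `n = 2` row of `P_M` is decided at every format except `m = 6`**, with the answer `m ≥ 7`: multiplicity domination of
`pad_m⟨2,2,2⟩` by `⟨m⟩` fails for `m ∈ {4,5}` and holds for `m ≥ 7`. [cite: BurgisserIkenmeyer2011, Lemma 6.1] [cite: Strassen1969] -/
theorem cellM_two_iff (h : 2 * 2 ≤ m) (hm6 : m ≠ 6) :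
    (∀ (Λ : Fin 3 → Fin m → ℕ) (d : ℕ), coMult (unitTensor ℂ m) Λ d ≤ coMult (padMM ℂ 2 m h) Λ d) ↔ 7 ≤ m := by
  constructor
  · intro hM
    by_contra hm
    exact not_cellM_of_le_sq_add_one 2 le_rfl h (by omega) hM
  · intro hm7 Λ d
    exact coMult_le_of_rank_le h ((tensorRank_matMulTensor_two_le_seven ℂ).trans hm7) Λ d

end Summit.MatrixMultiplication.MatrixMultiplication.Theorems.ObstructionCalculus

end
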